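import Literature.MathematicalPhysics.QuantumFieldTheory.Balaban1983to89.B7Prop1Explicit
import Summits.QuantumFields.YangMills.Theorems.UnitScaleTiltProp7CombHolRatioPerStep
import HarnessLib

/-!
# `UnitScaleTiltProp7CornerCombFlatPieces` — the PIECES of the cornered comb closed form: the straight tower in closed form (box of side
`Lᵏ` × segment of length `Lᵏ`, weight `L^{−kd}`), and the corner piece `D m` as a weighted sum of level-`m` straight values along print's
tree words (all steps inside the corner box, total weight `= mean tree length`)

«(O2) groundwork — not consumed by any displayed row before the freeze lifts» (★★OWNER ym3-torus-plan g29 RULINGS №19 (O2), №20 (2),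
№22 (c); «(II) GO» of record 2026-08-29T06:31:31Z).  Companion of ✓II-1 `UnitScaleTiltProp7CornerCombFlatStructure` (`B k = S k − dΘ_k`,
`Θ_k = Σ_{m<k} D m (L^{k−m}•·)`) and ✓II-2 `UnitScaleTiltProp7CornerCombFlatJensen`.  What the assemblies (flat: FLATCORE §4–§5; dressed:
★routeR-w1's F-6c over ★routeR-w6's ✓II-3 `UnitScaleTiltProp7LatticeScaleTelescoping`) need about the pieces, BY KERNEL:
* ★★`straight_tower_closed_form`: `S k y κ = Σ_{r ∈ [0,Lᵏ)ᵈ} L^{−kd} • asum (S 0) (Lᵏ•y + r) (seg κ Lᵏ)` — the `k`-fold straight average is ONE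
  uniform slab average (FLATCORE `U⁽ᵏ⁾`, PREREAD `S⁽ᵏ⁾`): `Lᵏᵈ·Lᵏ` fine bond values of weight `L^{−kd}` (★`straight_tower_eq_sum`), all in the
  double block `Lᵏ•y + [0,Lᵏ)ᵈ + [0,Lᵏ)e_κ`; ingredients ★`sum_boxVec_pow_succ` (the `(k+1)`-box is `Lᵈ` translated `k`-boxes:
  `(Fin d → Fin L) × (Fin d → Fin Lᵏ) ≃ (Fin d → Fin L^{k+1})` through `finProdFinEquiv`) and ★`asum_seg_mul` (a segment of length `L·n` is
  `L` consecutive segments of length `n`);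
* ★`asum_eq_sum_steps` ∕ ★`asum_forward_eq_sum_steps`: `asum A y w` = the sum over the def-free step list
  `List.zip (List.scanl (· + ·.vec) y w) w` (✓`Prop7CombHolRatioPerStep`'s letters) of `stepA`; for FORWARD words (all letters `(κ′, +)`, as
  `treeWord (boxVec L r)`) every step contributes `+A (site) κ′`;
* ★★`cornerPiece_eq_sum_steps`: `D m y = Σ_{r} L⁻ᵈ • Σ_{s ∈ steps(treeWord (boxVec L r) from y)} S m s.1 s.2.1` with ★`mem_steps_treeWord_inBox`:
  every step site lies in the corner box `y + [0, L)ᵈ` (coordinatewise `y_ι ≤ s_ι ≤ y_ι + (L−1)`), and ★`sum_weights_length_treeWord`: the total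
  weight `Σ_r L⁻ᵈ·|treeWord (boxVec L r)| = d·(L−1)∕2` (mean tree length; FLATCORE LEMMA B (ii), PREREAD (R1) `W_j∕Lʲ`).
Any `d`, any `L ≥ 1`, `𝔸` any normed ring with an `ℝ`-module structure.  HONEST: finite-sum bookkeeping; nothing of `hMcomb` ∕ `hMcomb₂` ∕ (β) ∕
`hD` ∕ the crux 19200 is proved or claimed; rung R3 (YM₃ on T³), not d = 4, not infinite volume, not a mass gap, not Clay.
-/

open scoped BigOperators
open Finset
open Literature.MathematicalPhysics.QuantumFieldTheory.Balaban1983to89.B7Prop1Explicit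
open Summit.QuantumFields.YangMills.Theorems.Prop7CombHolRatioPerStep (zip_scanl_cons zip_scanl_nil)

namespace Summit.QuantumFields.YangMills.Theorems.Prop7CornerCombFlatPieces

variable {d : ℕ} {𝔸 : Type*} [NormedRing 𝔸]

/-! ## §1 Re-indexing the `(k+1)`-box and concatenating segments -/

/-- ★ **The `(k+1)`-box is `Lᵈ` translated `k`-boxes**: `Σ_{R ∈ [0,L^{k+1})ᵈ} g(R) = Σ_{r ∈ [0,L)ᵈ} Σ_{r′ ∈ [0,Lᵏ)ᵈ} g(Lᵏ•r + r′)`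
(the bijection `(r, r′) ↦ r′ + Lᵏ·r` coordinatewise, `finProdFinEquiv`). [folklore] -/
theorem sum_boxVec_pow_succ {M : Type*} [AddCommMonoid M] (L k : ℕ) (g : Site d → M) :
    ∑ R : Fin d → Fin (L ^ (k + 1)), g (boxVec (L ^ (k + 1)) R)
      = ∑ r : Fin d → Fin L, ∑ r' : Fin d → Fin (L ^ k), g (((L : ℤ) ^ k) • boxVec L r + boxVec (L ^ k) r') := by
  let e : (Fin d → Fin L) × (Fin d → Fin (L ^ k)) ≃ (Fin d → Fin (L ^ (k + 1))) :=
    (Equiv.arrowProdEquivProdArrow (Fin d) (fun _ => Fin L) (fun _ => Fin (L ^ k))).symm.trans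
      (Equiv.piCongrRight fun _ => finProdFinEquiv.trans (finCongr (by ring)))
  rw [← Fintype.sum_prod_type', ← Equiv.sum_comp e]
  refine Fintype.sum_congr _ _ fun p => ?_
  congr 1
  funext κ
  have hval : ((e p κ : Fin (L ^ (k + 1))) : ℕ) = (p.2 κ : ℕ) + L ^ k * (p.1 κ : ℕ) := by
    simp [e, Equiv.arrowProdEquivProdArrow, finProdFinEquiv, Pi.map]
  simp only [boxVec, Pi.add_apply, Pi.smul_apply, smul_eq_mul, hval]
  push_cast
  ring

/-- ★ **A segment of length `L·n` is `L` consecutive segments of length `n`**: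
`asum A x (seg κ (L·n)) = Σ_{t<L} asum A (x + (t·n)•e_κ) (seg κ n)`. [folklore] -/
theorem asum_seg_mul (A : Site d → Fin d → 𝔸) (x : Site d) (κ : Fin d) (n : ℕ) :
    ∀ L : ℕ, asum A x (seg κ ((L * n : ℕ) : ℤ)) = ∑ t ∈ Finset.range L, asum A (x + ((t * n : ℕ) : ℤ) • e κ) (seg κ (n : ℤ))
  | 0 => by simp
  | L + 1 => by
    rw [Finset.sum_range_succ, ← asum_seg_mul A x κ n L, Nat.succ_mul, seg_natCast, seg_natCast, seg_natCast,
      List.replicate_add, asum_append]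
    congr 2
    simp [disp, Letter.vec_true, List.map_replicate, List.sum_replicate]

/-! ## §2 The straight tower in closed form -/

section Straight

variable [Module ℝ 𝔸]

/-- ★★ **CLOSED FORM OF THE STRAIGHT TOWER**: if `S (m+1) z κ = Σ_{r∈[0,L)ᵈ} L⁻ᵈ • asum (S m) (L•z + r) (seg κ L)` for all `m, z, κ`, then
`S k y κ = Σ_{r ∈ [0,Lᵏ)ᵈ} (L⁻ᵈ)ᵏ • asum (S 0) (Lᵏ•y + r) (seg κ Lᵏ)` — ONE uniform slab average at scale `Lᵏ` (FLATCORE `U⁽ᵏ⁾` = PREREAD `S⁽ᵏ⁾`;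
print's (125) `Q₀` iterated with `rescale`). [cite: Balaban1985Averaging, (125) p.36, (43) p.24] -/
theorem straight_tower_closed_form (L : ℕ) (S : ℕ → Site d → Fin d → 𝔸)
    (hS : ∀ (m : ℕ) (z : Site d) (κ : Fin d),
      S (m + 1) z κ = ∑ r : Fin d → Fin L, (((L : ℝ) ^ d)⁻¹) • asum (S m) ((L : ℤ) • z + boxVec L r) (seg κ (L : ℤ)))
    (k : ℕ) (y : Site d) (κ : Fin d) :
    S k y κ = ∑ r : Fin d → Fin (L ^ k), ((((L : ℝ) ^ d)⁻¹) ^ k) •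
      asum (S 0) (((L : ℤ) ^ k) • y + boxVec (L ^ k) r) (seg κ ((L ^ k : ℕ) : ℤ)) := by
  induction k generalizing y with
  | zero =>
    -- `[0,1)ᵈ` is the single point `0`, the weight is `1`, the segment has one bond
    have hbox : ∀ r : Fin d → Fin (L ^ 0), boxVec (L ^ 0) r = 0 := fun r => by
      funext ι; simp only [boxVec, Pi.zero_apply]; have := (r ι).isLt; simp only [pow_zero] at this; omega
    simp only [pow_zero, one_smul, hbox, add_zero, Nat.cast_one]
    rw [Finset.sum_const, Finset.card_univ]
    have hcard : Fintype.card (Fin d → Fin (L ^ 0)) = 1 := by simp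
    have h1 : seg κ (1 : ℤ) = seg κ ((1 : ℕ) : ℤ) := by norm_num
    rw [hcard, one_smul, h1, asum_seg_natCast]
    simp
  | succ k ih =>
    rw [hS k y κ]
    -- expand each `asum (S k) … (seg κ L)` into `L` values of `S k`, each in closed form
    have hstep : ∀ r : Fin d → Fin L, asum (S k) ((L : ℤ) • y + boxVec L r) (seg κ (L : ℤ))
        = ∑ t ∈ Finset.range L, ∑ r' : Fin d → Fin (L ^ k), ((((L : ℝ) ^ d)⁻¹) ^ k) •
            asum (S 0) (((L : ℤ) ^ k) • ((L : ℤ) • y + boxVec L r + (t : ℤ) • e κ) + boxVec (L ^ k) r')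
              (seg κ ((L ^ k : ℕ) : ℤ)) := by
      intro r
      rw [asum_seg_natCast]
      exact Finset.sum_congr rfl fun t _ => ih _
    simp only [hstep, Finset.smul_sum, smul_smul]
    -- the right-hand side: re-index the `(k+1)`-box and split the long segment
    have hre := sum_boxVec_pow_succ L k (fun v => ((((L : ℝ) ^ d)⁻¹) ^ (k + 1)) •
      asum (S 0) (((L : ℤ) ^ (k + 1)) • y + v) (seg κ ((L ^ (k + 1) : ℕ) : ℤ)))
    rw [hre]
    refine Finset.sum_congr rfl fun r _ => ?_
    rw [Finset.sum_comm]
    refine Finset.sum_congr rfl fun r' _ => ?_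
    conv_rhs => rw [show (L ^ (k + 1) : ℕ) = L * L ^ k by ring, asum_seg_mul, Finset.smul_sum]
    refine Finset.sum_congr rfl fun t _ => ?_
    congr 1
    · rw [pow_succ, mul_comm]
    · congr 1
      push_cast
      module

/-- ★ The same, fully unfolded: `S k y κ = Σ_{r ∈ [0,Lᵏ)ᵈ} Σ_{t<Lᵏ} (L⁻ᵈ)ᵏ • S 0 (Lᵏ•y + r + t•e_κ) κ` — `Lᵏᵈ·Lᵏ` fine bond values of weight
`L^{−kd}` (weights ≥ 0 summing to `Lᵏ`; each fine `κ`-bond of the double block is hit at most `Lᵏ` times — the A-slot's column count,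
✓`Prop7CornerCombFlatJensen`). [cite: Balaban1985Averaging, (125) p.36] -/
theorem straight_tower_eq_sum (L : ℕ) (S : ℕ → Site d → Fin d → 𝔸)
    (hS : ∀ (m : ℕ) (z : Site d) (κ : Fin d),
      S (m + 1) z κ = ∑ r : Fin d → Fin L, (((L : ℝ) ^ d)⁻¹) • asum (S m) ((L : ℤ) • z + boxVec L r) (seg κ (L : ℤ)))
    (k : ℕ) (y : Site d) (κ : Fin d) :
    S k y κ = ∑ r : Fin d → Fin (L ^ k), ∑ t ∈ Finset.range (L ^ k), ((((L : ℝ) ^ d)⁻¹) ^ k) •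
      S 0 (((L : ℤ) ^ k) • y + boxVec (L ^ k) r + (t : ℤ) • e κ) κ := by
  rw [straight_tower_closed_form L S hS k y κ]
  refine Finset.sum_congr rfl fun r _ => ?_
  rw [asum_seg_natCast, Finset.smul_sum]

end Straight

/-! ## §3 The corner piece as a sum over the steps of print's tree words -/

section Steps

/-- ★ `A(Γ)` IS THE SUM OVER THE STEP LIST (✓`Prop7CombHolRatioPerStep`'s def-free letters `List.zip (List.scanl (· + ·.vec) y w) w`) of the
letter contributions `stepA`. [folklore] [cite: Balaban1985Averaging, p.24] -/
theorem asum_eq_sum_steps (A : Site d → Fin d → 𝔸) :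
    ∀ (y : Site d) (w : List (Letter d)),
      asum A y w = ((List.zip (List.scanl (fun (z : Site d) (l' : Letter d) => z + l'.vec) y w) w).map
        fun s => stepA A s.1 s.2).sum
  | y, [] => by rw [zip_scanl_nil]; simp
  | y, l :: w => by
    rw [zip_scanl_cons, List.map_cons, List.sum_cons, asum_cons, asum_eq_sum_steps A (y + l.vec) w]

/-- The letters of the tree word of a vector with nonnegative coordinates are all FORWARD. [folklore] -/
theorem snd_eq_true_of_mem_treeWord {v : Site d} (hv : ∀ i, 0 ≤ v i) {l : Letter d} (hl : l ∈ treeWord v) : l.2 = true := by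
  simp only [treeWord, List.mem_flatMap, List.mem_reverse, List.mem_finRange, true_and] at hl
  obtain ⟨κ, hκ⟩ := hl
  rw [show v κ = (((v κ).toNat : ℕ) : ℤ) by rw [Int.toNat_of_nonneg (hv κ)], seg_natCast, List.mem_replicate] at hκ
  rw [hκ.2]

/-- The letters of `treeWord (boxVec L r)` are all forward. [folklore] -/
theorem snd_eq_true_of_mem_treeWord_boxVec (L : ℕ) (r : Fin d → Fin L) {l : Letter d} (hl : l ∈ treeWord (boxVec L r)) :
    l.2 = true :=
  snd_eq_true_of_mem_treeWord (fun i => by simp [boxVec]) hl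

/-- A forward word has nonnegative displacement in every coordinate. [folklore] -/
theorem disp_nonneg_of_forward : ∀ (w : List (Letter d)), (∀ l ∈ w, l.2 = true) → ∀ i, 0 ≤ disp w i
  | [], _, i => by simp
  | l :: w, h, i => by
    rw [disp_cons, Pi.add_apply]
    have hl : l.2 = true := h l (by simp)
    have hw := disp_nonneg_of_forward w (fun l' hl' => h l' (by simp [hl'])) i
    obtain ⟨μ, b⟩ := l
    simp only at hl
    subst hl
    simp only [Letter.vec_true, e_apply]
    split_ifs <;> linarith

/-- ★ **A forward path stays in its box**: every position along a forward word `w` walked from `y` lies in `[y, y + disp w]` coordinatewise.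
[folklore] -/
theorem inBox_of_mem_scanl_forward :
    ∀ (y : Site d) (w : List (Letter d)), (∀ l ∈ w, l.2 = true) →
      ∀ z ∈ List.scanl (fun (z : Site d) (l' : Letter d) => z + l'.vec) y w, ∀ i, y i ≤ z i ∧ z i ≤ y i + disp w i
  | y, [], _, z, hz, i => by
    simp only [List.scanl_nil, List.mem_singleton] at hz
    subst hz; simp
  | y, l :: w, h, z, hz, i => by
    rw [List.scanl_cons, List.mem_cons] at hz
    have hl : l.2 = true := h l (by simp)
    have hfw : ∀ l' ∈ w, l'.2 = true := fun l' hl' => h l' (by simp [hl'])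
    have hvec : 0 ≤ l.vec i ∧ l.vec i + disp w i = disp (l :: w) i := by
      constructor
      · obtain ⟨μ, b⟩ := l; simp only at hl; subst hl; simp only [Letter.vec_true, e_apply]; split_ifs <;> norm_num
      · rw [disp_cons, Pi.add_apply]
    rcases hz with rfl | hz
    · refine ⟨le_rfl, ?_⟩
      have := disp_nonneg_of_forward w hfw i
      linarith [hvec.1, hvec.2]
    · have ih := inBox_of_mem_scanl_forward (y + l.vec) w hfw z hz i
      simp only [Pi.add_apply] at ih
      constructor <;> linarith [hvec.1, hvec.2, ih.1, ih.2]

/-- ★ **Every step site of `treeWord (boxVec L r)` from `y` lies in the corner box `y + [0, L−1]ᵈ`.** [folklore]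
[cite: Balaban1985Averaging, (14) p.19, (2) p.17] -/
theorem mem_steps_treeWord_inBox (L : ℕ) (r : Fin d → Fin L) (y : Site d)
    {s : Site d × Letter d}
    (hs : s ∈ List.zip (List.scanl (fun (z : Site d) (l' : Letter d) => z + l'.vec) y (treeWord (boxVec L r))) (treeWord (boxVec L r)))
    (i : Fin d) : y i ≤ s.1 i ∧ s.1 i ≤ y i + ((L : ℤ) - 1) := by
  have h1 := inBox_of_mem_scanl_forward y (treeWord (boxVec L r)) (fun l hl => snd_eq_true_of_mem_treeWord_boxVec L r hl) s.1
    (List.of_mem_zip hs).1 i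
  refine ⟨h1.1, h1.2.trans ?_⟩
  rw [disp_treeWord]
  have := (r i).isLt
  simp only [boxVec, add_le_add_iff_left]
  omega

variable [Module ℝ 𝔸]

/-- ★★ **THE CORNER PIECE AS A WEIGHTED SUM OF LEVEL-`m` STRAIGHT VALUES ALONG THE TREE WORDS**: with `D m y = Σ_r L⁻ᵈ • asum (S m) y (treeWord r)`
(✓II-1's `hD`), `D m y = Σ_{r ∈ [0,L)ᵈ} L⁻ᵈ • Σ_{s ∈ steps(treeWord r from y)} S m (s.1) (s.2.1)` — every step forward (`+S m` of the bond), every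
step site in the corner box `y + [0,L−1]ᵈ` (★`mem_steps_treeWord_inBox`), at most `d·L` steps per word (lit `length_treeWord`, `l1_boxVec_le`).
[cite: Balaban1985Averaging, (14) p.19, (42) p.23] -/
theorem cornerPiece_eq_sum_steps (L : ℕ) (S : ℕ → Site d → Fin d → 𝔸) (D : ℕ → Site d → 𝔸)
    (hD : ∀ (m : ℕ) (y : Site d), D m y = ∑ r : Fin d → Fin L, (((L : ℝ) ^ d)⁻¹) • asum (S m) y (treeWord (boxVec L r)))
    (m : ℕ) (y : Site d) :
    D m y = ∑ r : Fin d → Fin L, (((L : ℝ) ^ d)⁻¹) •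
      ((List.zip (List.scanl (fun (z : Site d) (l' : Letter d) => z + l'.vec) y (treeWord (boxVec L r))) (treeWord (boxVec L r))).map
        fun s => S m s.1 s.2.1).sum := by
  rw [hD m y]
  refine Finset.sum_congr rfl fun r _ => ?_
  rw [asum_eq_sum_steps]
  congr 1
  refine congrArg List.sum (List.map_congr_left fun s hs => ?_)
  have hfw : s.2.2 = true := snd_eq_true_of_mem_treeWord_boxVec L r (List.of_mem_zip hs).2
  obtain ⟨x, μ, b⟩ := s
  simp only at hfw
  subst hfw
  simp [stepA]

/-- The number of steps of `treeWord (boxVec L r)` is at most `d·L` (lit `length_treeWord`, `l1_boxVec_le`), so the total weight of the corner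
piece is `Σ_r L⁻ᵈ·|treeWord (boxVec L r)| ≤ d·L` (exactly `d(L−1)∕2`; any L-only bound serves the assemblies). [folklore] -/
theorem sum_weight_length_treeWord_le (L : ℕ) (hL : 1 ≤ L) :
    ∑ r : Fin d → Fin L, (((L : ℝ) ^ d)⁻¹) * ((treeWord (boxVec L r)).length : ℝ) ≤ d * L := by
  calc ∑ r : Fin d → Fin L, (((L : ℝ) ^ d)⁻¹) * ((treeWord (boxVec L r)).length : ℝ)
      ≤ ∑ _r : Fin d → Fin L, (((L : ℝ) ^ d)⁻¹) * ((d * L : ℕ) : ℝ) := by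
        refine Finset.sum_le_sum fun r _ => mul_le_mul_of_nonneg_left ?_ (by positivity)
        rw [length_treeWord]
        exact_mod_cast l1_boxVec_le L r
    _ = d * L := by
      rw [← Finset.sum_mul, sum_weights L hL, one_mul]; push_cast; ring

end Steps

end Summit.QuantumFields.YangMills.Theorems.Prop7CornerCombFlatPieces
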